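import Summits.CriticalPhenomena.PercolationContinuityZ3.Theorems.PercNearOneGluingNoHeavyLowerTailCILApproxChampion
import Literature.Probability.Percolation.TwoClusterExchange
import HarnessLib

/-!
# `NoHeavyLowerTail` (stmt-CriticalPhenomena-4575), line induct — the FIRST DISPLACED-CHAMPION THEOREM (level one)

Support file (prover `prim-gen-induct`, gen 5; `--supports stmt-CriticalPhenomena-4575`).  No definitions, no
named facts, no sorries.  Notation as in `…CILApproxChampion.lean`: `L_x = {x ↮ A ∖ x}`, `I_x = μ(L_x)`,
`N_u = |{a ∈ A : u ↔ a}|`.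

* `DisplacedChampion.exchange_lonely_off` — one two-cluster exchange row (BHK 2006 Thm 1.5,
  `twoClusterExchange`): `μ(L_x, u ↮ c) · I_c ≤ I_x · μ(L_c, u ↮ c)` for relays `x ≠ c` and any vertex `u`.
* `DisplacedChampion.displacedChampion_levelOne` — **DC1**: for relays `a, b, c` (`a, b ≠ c`), any vertex `u`,
  `α, β ∈ [0,1]`: if `I_x ≤ I_c` for `x ∈ A ∖ {a,b}` and `(1−αβ)·I_a ≤ I_c`, `(1−αβ)·I_b ≤ I_c`, then
  `(1−α)(1−β)·μ(N_u = 1, u ↮ c) + α(1−β)·μ(L_a, u ↮ A∖a) + β(1−α)·μ(L_b, u ↮ A∖b) ≤ μ(L_c, u ↮ c)`.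
  MEANING.  The hypothesis says that `c` is the level-one champion of `H = K + v + v′` where `v` hangs on the
  non-relay vertex `u` and a fresh non-relay `v′` is joined to the relay gates `a, b` with probabilities `α, β`
  (then `I_H(a) = (1−αβ)I_a`, `I_H(x) = I_x` otherwise); the conclusion is EXACTLY `P_{K′}(N_u = 1) ≤ I_{K′}(c)`
  for `K′ = K + α·(ua) + β·(ub)` after the one-bond decompositions of the two new pairs, i.e. `c` is a valid
  CIL₁ witness at `u` in `K′` although it is the champion of a DIFFERENT graph (`K` with an extra `αβ`-pair
  `ab`).  Consequently the set-champion-stability STEP `CS_H({v,v′}, c)` of `…CILInductionStep` holds at level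
  one for this whole family of one-Steiner-gate three-gate cells (crux notes BLOBQUOTIENT.md §23), for every `K`,
  every `|A|`, all `α, β, γ` — the family containing the (3,1) "CLEAN-6b" cell for which an exact certificate
  (NOGO-RANKING-LINEAR.md) shows that NO proof by ranking-conditional linear inequalities in the `K`-law exists.
  The proof is the convex combination `(1−α)(1−β)·[ACIL₁ with θ = αβ] + α(1−β)·[exchange at a] +
  β(1−α)·[exchange at b]`; the championship discounts cancel exactly:
  `[(1−α)(1−β) + α(1−β) + β(1−α)]/(1−αβ) = 1`.
-/

namespace Summit.CriticalPhenomena.PercolationContinuityZ3.Theorems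

open scoped BigOperators Classical Topology
open MeasureTheory Set Filter
open Literature.Probability.LatticeModels (prodBernoulli)
open Literature.Probability.Percolation (openConn openGraph BondConfig twoClusterExchange
  typePlus_not_openConn typeMinus_not_openConn)

namespace DisplacedChampion

variable {n : ℕ}

/-- **Exchange row** (one instance of BHK 2006 Thm 1.5): for relays `x ≠ c` in `A` and any vertex `u`,
`μ(x ↮ A∖x, u ↮ c) · μ(c ↮ A∖c) ≤ μ(x ↮ A∖x) · μ(c ↮ A∖c, u ↮ c)` — given `{x ↮ c}`, the loneliness of `c`
(type `(+)`) and `{u ↮ c}` (type `(+)`) are positively, and both are negatively correlated with the loneliness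
of `x` (type `(−)`). [cite: VandenbergHaggstromKahn2005, Thm. 1.5 (p. 7) — corollary] -/
theorem exchange_lonely_off (w : Sym2 (Fin n) → unitInterval) (A : Finset (Fin n)) (x c u : Fin n)
    (hx : x ∈ A) (hc : c ∈ A) (hxc : x ≠ c) :
    (prodBernoulli w).real ({ω | ∀ t ∈ A.erase x, ω ∉ openConn x t} ∩ (openConn c u)ᶜ) *
        (prodBernoulli w).real {ω | ∀ t ∈ A.erase c, ω ∉ openConn c t} ≤
      (prodBernoulli w).real {ω | ∀ t ∈ A.erase x, ω ∉ openConn x t} *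
        (prodBernoulli w).real ({ω | ∀ t ∈ A.erase c, ω ∉ openConn c t} ∩ (openConn c u)ᶜ) := by
  set μ := prodBernoulli w with hμ
  set Lc : Set (BondConfig (Fin n)) := {ω | ∀ t ∈ A.erase c, ω ∉ openConn c t} with hLc
  set Lx : Set (BondConfig (Fin n)) := {ω | ∀ t ∈ A.erase x, ω ∉ openConn x t} with hLx
  set U : Set (BondConfig (Fin n)) := (openConn c u)ᶜ with hU
  have key := twoClusterExchange w hxc (A₁ := Lc) (A₂ := U) (B₁ := (univ : Set (BondConfig (Fin n))))
    (B₂ := Lx)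
    (fun ω ω' hs ht h t ht' => typePlus_not_openConn x c t hs ht (h t ht'))
    (fun ω ω' hs ht h => typePlus_not_openConn x c u hs ht h)
    (fun _ _ _ _ _ => mem_univ _)
    (fun ω ω' hs ht h t ht' => typeMinus_not_openConn x c t hs ht (h t ht'))
  -- `D = {x ↮ c}` contains both loneliness events
  have hcx : c ∈ A.erase x := Finset.mem_erase.2 ⟨hxc.symm, hc⟩
  have hxc' : x ∈ A.erase c := Finset.mem_erase.2 ⟨hxc, hx⟩
  have hDx : ∀ S : Set (BondConfig (Fin n)), (openConn x c)ᶜ ∩ (S ∩ Lx) = S ∩ Lx := by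
    intro S
    ext ω
    simp only [mem_inter_iff, mem_compl_iff]
    constructor
    · rintro ⟨-, h⟩; exact h
    · rintro ⟨hS, hL⟩; exact ⟨hL c hcx, hS, hL⟩
  have hDc : ∀ S : Set (BondConfig (Fin n)), (openConn x c)ᶜ ∩ (Lc ∩ S) = Lc ∩ S := by
    intro S
    ext ω
    simp only [mem_inter_iff, mem_compl_iff]
    constructor
    · rintro ⟨-, h⟩; exact h
    · rintro ⟨hL, hS⟩
      refine ⟨?_, hL, hS⟩
      have := hL x hxc'
      rwa [knThm2_openConn_comm] at this
  rw [inter_univ, univ_inter, hDx, hDc] at key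
  have hD1 : (openConn x c)ᶜ ∩ Lc = Lc := by
    simpa only [inter_univ] using hDc univ
  have hD2 : (openConn x c)ᶜ ∩ Lx = Lx := by
    simpa only [univ_inter] using hDx univ
  rw [hD1, hD2] at key
  -- key : μ Lc * μ (U ∩ Lx) ≤ μ (Lc ∩ U) * μ Lx
  calc μ.real (Lx ∩ U) * μ.real Lc = μ.real Lc * μ.real (U ∩ Lx) := by rw [inter_comm, mul_comm]
    _ ≤ μ.real (Lc ∩ U) * μ.real Lx := key
    _ = μ.real Lx * μ.real (Lc ∩ U) := mul_comm _ _

/-- **THE DISPLACED CHAMPION INEQUALITY AT LEVEL ONE (DC1).**  Relays `a, b, c ∈ A` pairwise distinct, any vertex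
`u`, `α, β ∈ [0,1]`; `L_x = {x ↮ A∖x}`, `I_x = μ(L_x)`.  If `I_x ≤ I_c` for every relay `x ∉ {a, b}` and
`(1−αβ)·I_a ≤ I_c`, `(1−αβ)·I_b ≤ I_c` (i.e. `c` is the level-one champion of the graph in which a fresh non-relay
vertex is joined to `a` and `b` with probabilities `α`, `β`), then
`(1−α)(1−β)·μ(N_u = 1, u ↮ c) + α(1−β)·μ(L_a, u ↮ A∖a) + β(1−α)·μ(L_b, u ↮ A∖b) ≤ μ(L_c, u ↮ c)`,
which is the statement that `c` is a valid CIL₁ witness at `u` after joining `u` to `a` and `b` with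
probabilities `α`, `β` — a witness that is the champion of a different graph. -/
theorem displacedChampion_levelOne (w : Sym2 (Fin n) → unitInterval) (A : Finset (Fin n))
    (a b c u : Fin n) (ha : a ∈ A) (hb : b ∈ A) (hc : c ∈ A) (hac : a ≠ c) (hbc : b ≠ c)
    (α β : ℝ) (hα0 : 0 ≤ α) (hα1 : α ≤ 1) (hβ0 : 0 ≤ β) (hβ1 : β ≤ 1)
    (hchamp : ∀ x ∈ A, x ≠ a → x ≠ b →
      (prodBernoulli w).real {ω | ∀ t ∈ A.erase x, ω ∉ openConn x t} ≤
        (prodBernoulli w).real {ω | ∀ t ∈ A.erase c, ω ∉ openConn c t})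
    (hchampa : (1 - α * β) * (prodBernoulli w).real {ω | ∀ t ∈ A.erase a, ω ∉ openConn a t} ≤
        (prodBernoulli w).real {ω | ∀ t ∈ A.erase c, ω ∉ openConn c t})
    (hchampb : (1 - α * β) * (prodBernoulli w).real {ω | ∀ t ∈ A.erase b, ω ∉ openConn b t} ≤
        (prodBernoulli w).real {ω | ∀ t ∈ A.erase c, ω ∉ openConn c t}) :
    (1 - α) * (1 - β) * (prodBernoulli w).real
        ({ω : Set (Sym2 (Fin n)) | (A.filter fun z => ω ∈ openConn u z).card = 1} ∩ (openConn c u)ᶜ) +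
      α * (1 - β) * (prodBernoulli w).real
        ({ω | ∀ t ∈ A.erase a, ω ∉ openConn a t} ∩ {ω | ∀ t ∈ A.erase a, ω ∉ openConn u t}) +
      β * (1 - α) * (prodBernoulli w).real
        ({ω | ∀ t ∈ A.erase b, ω ∉ openConn b t} ∩ {ω | ∀ t ∈ A.erase b, ω ∉ openConn u t}) ≤
      (prodBernoulli w).real ({ω | ∀ t ∈ A.erase c, ω ∉ openConn c t} ∩ (openConn c u)ᶜ) := by
  set μ := prodBernoulli w with hμ
  set L : Fin n → Set (BondConfig (Fin n)) := fun x => {ω | ∀ t ∈ A.erase x, ω ∉ openConn x t} with hL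
  set U : Set (BondConfig (Fin n)) := (openConn c u)ᶜ with hU
  set Z := μ.real (L c ∩ U) with hZ
  set Bd := μ.real ({ω : Set (Sym2 (Fin n)) | (A.filter fun z => ω ∈ openConn u z).card = 1} ∩ U)
    with hBd
  set Pa := μ.real (L a ∩ {ω | ∀ t ∈ A.erase a, ω ∉ openConn u t}) with hPa
  set Pb := μ.real (L b ∩ {ω | ∀ t ∈ A.erase b, ω ∉ openConn u t}) with hPb
  have hκ0 : 0 ≤ 1 - α * β := by nlinarith
  have hZ0 : 0 ≤ Z := measureReal_nonneg
  have hZle : Z ≤ μ.real (L c) := measureReal_mono inter_subset_left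
  -- (1) ACIL₁ with θ = αβ
  have h1 : (1 - α * β) * Bd ≤ Z := by
    refine approxChampion_lonelyRelay w A u c hc (α * β) (by positivity) (by nlinarith) ?_
    intro x hx hxc
    by_cases hxa : x = a
    · subst hxa; exact hchampa
    by_cases hxb : x = b
    · subst hxb; exact hchampb
    have := hchamp x hx hxa hxb
    have h0 : 0 ≤ μ.real (L x) := measureReal_nonneg
    have hab0 : 0 ≤ α * β * μ.real (L x) := mul_nonneg (mul_nonneg hα0 hβ0) h0
    change (1 - α * β) * μ.real (L x) ≤ μ.real (L c)
    change μ.real (L x) ≤ μ.real (L c) at this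
    nlinarith
  -- (2) exchange at a gate `g ∈ {a, b}`: (1 - αβ) P_g ≤ Z
  have hgate : ∀ g ∈ A, g ≠ c →
      (1 - α * β) * μ.real (L g) ≤ μ.real (L c) →
      (1 - α * β) * μ.real (L g ∩ {ω | ∀ t ∈ A.erase g, ω ∉ openConn u t}) ≤ Z := by
    intro g hg hgc hchampg
    -- the event `{L_g, u ↮ A∖g}` lies in `{L_g, u ↮ c}`
    have hsub : L g ∩ {ω | ∀ t ∈ A.erase g, ω ∉ openConn u t} ⊆ L g ∩ U := by
      rintro ω ⟨hLg, hu⟩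
      refine ⟨hLg, ?_⟩
      have := hu c (Finset.mem_erase.2 ⟨hgc.symm, hc⟩)
      change ω ∉ openConn c u
      rwa [knThm2_openConn_comm] at this
    have hPle : μ.real (L g ∩ {ω | ∀ t ∈ A.erase g, ω ∉ openConn u t}) ≤ μ.real (L g ∩ U) :=
      measureReal_mono hsub
    have hex := exchange_lonely_off w A g c u hg hc hgc
    -- hex : μ(L g ∩ U) * μ(L c) ≤ μ(L g) * Z
    have hP0 : 0 ≤ μ.real (L g ∩ {ω | ∀ t ∈ A.erase g, ω ∉ openConn u t}) := measureReal_nonneg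
    by_cases hIc : μ.real (L c) = 0
    · -- then Z = 0 and (1-αβ) μ(L g) ≤ 0, so the left side vanishes
      have hZ0' : Z = 0 := le_antisymm (hIc ▸ hZle) hZ0
      have h3 : (1 - α * β) * μ.real (L g) ≤ 0 := hIc ▸ hchampg
      have h4 : (1 - α * β) * μ.real (L g ∩ {ω | ∀ t ∈ A.erase g, ω ∉ openConn u t}) ≤
          (1 - α * β) * μ.real (L g) :=
        mul_le_mul_of_nonneg_left (measureReal_mono inter_subset_left) hκ0
      linarith
    · have hIcpos : 0 < μ.real (L c) := lt_of_le_of_ne measureReal_nonneg (Ne.symm hIc)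
      -- (1-αβ) μ(L g ∩ U) μ(L c) ≤ (1-αβ) μ(L g) Z ≤ μ(L c) Z
      have h5 : (1 - α * β) * μ.real (L g ∩ U) * μ.real (L c) ≤ μ.real (L c) * Z := by
        calc (1 - α * β) * μ.real (L g ∩ U) * μ.real (L c)
            = (1 - α * β) * (μ.real (L g ∩ U) * μ.real (L c)) := by ring
          _ ≤ (1 - α * β) * (μ.real (L g) * Z) := mul_le_mul_of_nonneg_left hex hκ0
          _ = ((1 - α * β) * μ.real (L g)) * Z := by ring
          _ ≤ μ.real (L c) * Z := mul_le_mul_of_nonneg_right hchampg hZ0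
      have h6 : (1 - α * β) * μ.real (L g ∩ U) ≤ Z := by
        have : ((1 - α * β) * μ.real (L g ∩ U)) * μ.real (L c) ≤ Z * μ.real (L c) := by
          rw [mul_comm Z]; exact h5
        exact le_of_mul_le_mul_right this hIcpos
      calc (1 - α * β) * μ.real (L g ∩ {ω | ∀ t ∈ A.erase g, ω ∉ openConn u t})
          ≤ (1 - α * β) * μ.real (L g ∩ U) := mul_le_mul_of_nonneg_left hPle hκ0
        _ ≤ Z := h6
  have h2 : (1 - α * β) * Pa ≤ Z := hgate a ha hac hchampa
  have h3 : (1 - α * β) * Pb ≤ Z := hgate b hb hbc hchampb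
  -- (3) the convex combination; the discounts cancel exactly
  have hBd0 : 0 ≤ Bd := measureReal_nonneg
  have hPa0 : 0 ≤ Pa := measureReal_nonneg
  have hPb0 : 0 ≤ Pb := measureReal_nonneg
  by_cases hκ : 1 - α * β = 0
  · -- then α = β = 1 and every coefficient on the left vanishes
    have hα : α = 1 := by nlinarith
    have hβ : β = 1 := by nlinarith
    subst hα; subst hβ
    simp only [sub_self, mul_zero, zero_mul, zero_add]
    exact hZ0
  · have hκpos : 0 < 1 - α * β := lt_of_le_of_ne hκ0 (Ne.symm hκ)
    have hw1 : 0 ≤ (1 - α) * (1 - β) := by nlinarith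
    have hw2 : 0 ≤ α * (1 - β) := by nlinarith
    have hw3 : 0 ≤ β * (1 - α) := by nlinarith
    have hsum : (1 - α * β) * ((1 - α) * (1 - β) * Bd + α * (1 - β) * Pa + β * (1 - α) * Pb) ≤
        (1 - α * β) * Z := by
      have e1 := mul_le_mul_of_nonneg_left h1 hw1
      have e2 := mul_le_mul_of_nonneg_left h2 hw2
      have e3 := mul_le_mul_of_nonneg_left h3 hw3
      have hid : (1 - α) * (1 - β) * Z + α * (1 - β) * Z + β * (1 - α) * Z = (1 - α * β) * Z := by ring
      nlinarith
    exact le_of_mul_le_mul_left hsum hκpos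

end DisplacedChampion

end Summit.CriticalPhenomena.PercolationContinuityZ3.Theorems
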